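import Mathlib
import Summits.NavierStokesRegularity.NavierStokesRegularity.Theorems.SubOnsagerCeilingDefs
import Summits.NavierStokesRegularity.NavierStokesRegularity.Theorems.SubOnsagerCeilingGapChain10
import HarnessLib

/-!
# Relabeling covariance of the shell barrier, the tail ceiling and the primary graded barrier
# (helper file for the crux `SubOnsagerCeiling.ForwardTailCeilingKP`, stmt-NavierStokesRegularity-27057, `--supports`)

The registered stubs `stub_primaryGradedLargeRatio` / `stub_primaryGradedSmallRatio` of the LEAD skeleton
`Cruxes/ForwardTailCeilingKP/Lines/kp_shell_barrier.lean` (v19) ask for `PrimaryGradedAt R ε₀ α` for EVERY KP network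
proper `α`; every landed corner, however, is stated for ONE placement of its architecture on the four components
(`IsScaledDyadic` = the Katz–Pavlović chain on component `0`, the side-branch class on components `0,1,2`, the fan
from component `0`, the re-entry pair on `0,1`, …).  This file proves, once and for the whole class, that all the
predicates involved are COVARIANT UNDER RELABELING the components by a permutation `σ : Equiv.Perm (Fin 4)`,
`β i₁ i₂ i₃ μ = α (σ i₁) (σ i₂) (σ i₃) μ` (hypothesis `hβ`, stated pointwise so that concrete tables are matched by
`rfl`/`simp`):

* §1 `kpRelabel_quadTerm` — `quadTerm ε₀ β X i n t = quadTerm ε₀ α (X ∘ σ⁻¹) (σ i) n t` (reindexing the double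
  mode sum by `σ`), and the invariance of Tao's table class `E₂(R)` (`kpRelabel_inTableClass`: symmetry (4.2),
  cancellation (4.3), comparability), of the ORTHANT sign predicate (`kpRelabel_orthant`) and of the DIAGONAL-FEED
  clause (`kpRelabel_diagonal`); `kpRelabel_symm` inverts `hβ`.
* §2 `kpRelabel_shellBarrierAt`, `kpRelabel_ceilingAt` — `ShellBarrierAt R ε₀ α → ShellBarrierAt R ε₀ β` and
  `CeilingAt R ε₀ α → CeilingAt R ε₀ β` (solutions of `β` are relabeled solutions of `α`; the datum energy and the
  full shell sums are `σ`-invariant), so every landed `CeilingAt` / `ShellBarrierAt` rung holds at all `24`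
  placements of its architecture.
* §3 `kpRelabel_primaryGraded` — the body of `PrimaryGradedAt R ε₀ α` (skeleton v6–v19, verbatim, with its
  structural clauses `GradedStruct α lev` verbatim) transports to `β` with the grading `lev ∘ σ`.
* §4 `kpRelabel_fwdCeilingKPAt` — the per-table body `FwdCeilingKPAt R ε₀ α` of the crux (verbatim) transports to
  `β` with the forward-source set `S.map σ⁻¹`.
* §5 `kpRelabel_chain_shellBarrierAt` — first use: the Katz–Pavlović chain `c·dyadicTable` placed on ANY component
  (`β i₁ i₂ i₃ μ = c·dyadicTable (σ i₁) (σ i₂) (σ i₃) μ`) obeys `ShellBarrierAt R ε₀ β` (`θ = 101/200`, `D = 100`) at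
  every `ε₀ ∈ [9/25, 1]`, from the landed one-placement rung `dyadicGapRange10Wide_shellBarrierAt` (LEAD g12, RUNG 18).

HONEST FRAMING: bookkeeping about Tao-type MODEL lattice ODEs (route SubOnsagerCeiling, rung TL-M2Break); no stub,
crux or summit is proved and nothing here bears on Navier–Stokes regularity.
[cite: Tao2016AveragedNS, §4 (4.2)–(4.3), (4.8), (4.13)]
-/

noncomputable section

-- the sub-problem namespace `NavierStokesRegularity.NavierStokesRegularity` is the tree's layout (D-0017)
set_option linter.dupNamespace false

namespace Summit.NavierStokesRegularity.NavierStokesRegularity.Theorems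

open Set Finset
open Literature.Analysis.FluidPDE.TaoCascade
open Summit.NavierStokesRegularity.NavierStokesRegularity.Theorems.SubOnsagerCeiling

variable {α β : Fin 4 → Fin 4 → Fin 4 → ℤ × ℤ × ℤ → ℝ} (σ : Equiv.Perm (Fin 4))

/-! ## §1 The nonlinearity, the table class, the orthant predicate under relabeling -/

/-- **Relabeling the components reindexes the cascade nonlinearity**: if `β i₁ i₂ i₃ μ = α (σ i₁) (σ i₂) (σ i₃) μ`
then `quadTerm ε₀ β X i n t = quadTerm ε₀ α (X ∘ σ⁻¹) (σ i) n t`. [cite: Tao2016AveragedNS, §4 (4.8)] -/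
theorem kpRelabel_quadTerm (ε₀ : ℝ) (hβ : ∀ i₁ i₂ i₃ μ, β i₁ i₂ i₃ μ = α (σ i₁) (σ i₂) (σ i₃) μ)
    (X : Fin 4 → ℤ → ℝ → ℝ) (i : Fin 4) (n : ℤ) (t : ℝ) :
    quadTerm ε₀ β X i n t = quadTerm ε₀ α (fun j => X (σ.symm j)) (σ i) n t := by
  simp only [quadTerm, hβ]
  refine Fintype.sum_equiv σ _ _ fun i₁ => ?_
  refine Fintype.sum_equiv σ _ _ fun i₂ => ?_
  simp only [Equiv.symm_apply_apply]

/-- Inverting the relabeling: `α i₁ i₂ i₃ μ = β (σ⁻¹ i₁) (σ⁻¹ i₂) (σ⁻¹ i₃) μ`. [cite: Tao2016AveragedNS, §4 (4.2)] -/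
theorem kpRelabel_symm (hβ : ∀ i₁ i₂ i₃ μ, β i₁ i₂ i₃ μ = α (σ i₁) (σ i₂) (σ i₃) μ) :
    ∀ i₁ i₂ i₃ μ, α i₁ i₂ i₃ μ = β (σ.symm i₁) (σ.symm i₂) (σ.symm i₃) μ := by
  intro i₁ i₂ i₃ μ
  rw [hβ, Equiv.apply_symm_apply, Equiv.apply_symm_apply, Equiv.apply_symm_apply]

/-- The symmetry condition (4.2) is invariant under relabeling. [cite: Tao2016AveragedNS, §4 (4.2)] -/
theorem kpRelabel_isSymmetricCoeff (hβ : ∀ i₁ i₂ i₃ μ, β i₁ i₂ i₃ μ = α (σ i₁) (σ i₂) (σ i₃) μ)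
    (h : IsSymmetricCoeff α) : IsSymmetricCoeff β := by
  intro i₁ i₂ i₃ μ₁ μ₂ μ₃ hμ
  rw [hβ, hβ]
  exact h _ _ _ _ _ _ hμ

/-- The cancellation condition (4.3) is invariant under relabeling. [cite: Tao2016AveragedNS, §4 (4.3)] -/
theorem kpRelabel_isCancellingCoeff (hβ : ∀ i₁ i₂ i₃ μ, β i₁ i₂ i₃ μ = α (σ i₁) (σ i₂) (σ i₃) μ)
    (h : IsCancellingCoeff α) : IsCancellingCoeff β := by
  intro i₁ i₂ i₃ μ₁ μ₂ μ₃ hμ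
  simp only [hβ]
  exact h _ _ _ _ _ _ hμ

/-- `R`-comparability is invariant under relabeling. [cite: Tao2016AveragedNS, §6.1] -/
theorem kpRelabel_isComparableCoeff {R : ℝ} (hβ : ∀ i₁ i₂ i₃ μ, β i₁ i₂ i₃ μ = α (σ i₁) (σ i₂) (σ i₃) μ)
    (h : IsComparableCoeff R α) : IsComparableCoeff R β := by
  intro i₁ i₂ i₃ μ hμ
  rw [hβ]
  exact h _ _ _ μ hμ

/-- **Tao's table class `E₂(R)` is invariant under relabeling the components.**
[cite: Tao2016AveragedNS, §4 (4.2)–(4.3)] -/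
theorem kpRelabel_inTableClass {R : ℝ} (hβ : ∀ i₁ i₂ i₃ μ, β i₁ i₂ i₃ μ = α (σ i₁) (σ i₂) (σ i₃) μ)
    (h : InTableClass R α) : InTableClass R β :=
  ⟨kpRelabel_isSymmetricCoeff σ hβ h.1, kpRelabel_isCancellingCoeff σ hβ h.2.1,
    kpRelabel_isComparableCoeff σ hβ h.2.2⟩

/-- **The ORTHANT sign predicate is invariant under relabeling**: if the non-negative orthant (shells `≥ 1`) is
forward-invariant for `α` at every scale ratio, then also for the relabeled table.
[cite: Tao2016AveragedNS, §4 (4.8)] -/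
theorem kpRelabel_orthant (hβ : ∀ i₁ i₂ i₃ μ, β i₁ i₂ i₃ μ = α (σ i₁) (σ i₂) (σ i₃) μ)
    (h : ∀ (Y : Fin 4 → ℤ → ℝ → ℝ) (τ : ℝ), (∀ (j : Fin 4) (k : ℤ), 1 ≤ k → 0 ≤ Y j k τ) → ∀ δ : ℝ, 0 < δ →
      ∀ (i : Fin 4) (n : ℤ), 1 ≤ n → Y i n τ = 0 → 0 ≤ quadTerm δ α Y i n τ) :
    ∀ (Y : Fin 4 → ℤ → ℝ → ℝ) (τ : ℝ), (∀ (j : Fin 4) (k : ℤ), 1 ≤ k → 0 ≤ Y j k τ) → ∀ δ : ℝ, 0 < δ →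
      ∀ (i : Fin 4) (n : ℤ), 1 ≤ n → Y i n τ = 0 → 0 ≤ quadTerm δ β Y i n τ := by
  intro Y τ hY δ hδ i n hn hYi
  rw [kpRelabel_quadTerm σ δ hβ]
  refine h (fun j => Y (σ.symm j)) τ (fun j k hk => hY _ k hk) δ hδ (σ i) n hn ?_
  simp only [Equiv.symm_apply_apply]
  exact hYi

/-- The DIAGONAL-FEED clause (KP networks proper) is invariant under relabeling. [cite: Tao2016AveragedNS, §4 (4.2)] -/
theorem kpRelabel_diagonal (hβ : ∀ i₁ i₂ i₃ μ, β i₁ i₂ i₃ μ = α (σ i₁) (σ i₂) (σ i₃) μ)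
    (h : ∀ a b i : Fin 4, a ≠ b → α a b i (0, 0, 1) = 0) :
    ∀ a b i : Fin 4, a ≠ b → β a b i (0, 0, 1) = 0 := by
  intro a b i hab
  rw [hβ]
  exact h _ _ _ fun h' => hab (σ.injective h')

/-- Relabeled solutions: if `X` solves the `ν`-viscous equation of `β` within `[0,s]`, then `X ∘ σ⁻¹` solves that of
`α`. [cite: Tao2016AveragedNS, §4 (4.13)] -/
theorem kpRelabel_hasDerivWithinAt {ε₀ ν s : ℝ} (hβ : ∀ i₁ i₂ i₃ μ, β i₁ i₂ i₃ μ = α (σ i₁) (σ i₂) (σ i₃) μ)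
    {X : Fin 4 → ℤ → ℝ → ℝ}
    (hXd : ∀ (i : Fin 4) (k : ℤ), ∀ t ∈ Set.Icc (0 : ℝ) s, HasDerivWithinAt (X i k)
      (quadTerm ε₀ β X i k t - ν * (1 + ε₀) ^ ((2 : ℝ) * k) * X i k t) (Set.Icc (0 : ℝ) s) t) :
    ∀ (i : Fin 4) (k : ℤ), ∀ t ∈ Set.Icc (0 : ℝ) s, HasDerivWithinAt ((fun j => X (σ.symm j)) i k)
      (quadTerm ε₀ α (fun j => X (σ.symm j)) i k t - ν * (1 + ε₀) ^ ((2 : ℝ) * k) * (fun j => X (σ.symm j)) i k t)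
      (Set.Icc (0 : ℝ) s) t := by
  intro i k t ht
  have h := hXd (σ.symm i) k t ht
  rw [kpRelabel_quadTerm σ ε₀ hβ, Equiv.apply_symm_apply] at h
  exact h

/-- The datum energy is invariant under relabeling. [cite: Tao2016AveragedNS, §4 (4.6)] -/
theorem kpRelabel_datumEnergy (X₀ : Fin 4 → ℝ) :
    ∑ j : Fin 4, (1 / 2 : ℝ) * X₀ (σ.symm j) ^ 2 = ∑ j : Fin 4, (1 / 2 : ℝ) * X₀ j ^ 2 :=
  Equiv.sum_comp σ.symm (fun j => (1 / 2 : ℝ) * X₀ j ^ 2)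

/-! ## §2 The shell barrier and the tail ceiling under relabeling -/

/-- **`ShellBarrierAt` is covariant under relabeling the components**: a `ν`-uniform weighted shell barrier for
`α` gives the same barrier (same `θ`, same `D`) for every relabeled table `β`.  So every landed `ShellBarrierAt`
rung (the Katz–Pavlović chain on component `0` at every `b ∈ [34/25, 2]`, …) holds for all placements of its
architecture. [cite: BarbatoMorandinRomito2011, §3.2 (shape of the barrier)] [cite: Tao2016AveragedNS, §4 (4.13)] -/
theorem kpRelabel_shellBarrierAt {R ε₀ : ℝ} (hβ : ∀ i₁ i₂ i₃ μ, β i₁ i₂ i₃ μ = α (σ i₁) (σ i₂) (σ i₃) μ)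
    (h : ShellBarrierAt R ε₀ α) : ShellBarrierAt R ε₀ β := by
  intro hT hO
  have hα := kpRelabel_symm σ hβ
  obtain ⟨θ, hθ, D, hD, H⟩ := h (kpRelabel_inTableClass σ.symm hα hT) (kpRelabel_orthant σ.symm hα hO)
  refine ⟨θ, hθ, D, hD, ?_⟩
  intro ν hν X₀ s hs X hX0 hXneg hM hXc hXd hXpos t ht i k
  obtain ⟨M, hM⟩ := hM
  have key := H ν hν (fun j => X₀ (σ.symm j)) s hs (fun j => X (σ.symm j)) (fun j k' => hX0 (σ.symm j) k')
    (fun j k' hk' t' => hXneg (σ.symm j) k' hk' t') ⟨M, fun t' j k' => hM t' (σ.symm j) k'⟩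
    (fun j k' => hXc (σ.symm j) k') (kpRelabel_hasDerivWithinAt σ hβ hXd)
    (fun t' ht' j k' hk' => hXpos t' ht' (σ.symm j) k' hk') t ht (σ i) k
  rw [kpRelabel_datumEnergy σ X₀] at key
  simpa only [Equiv.symm_apply_apply] using key

/-- **`CeilingAt` is covariant under relabeling the components**: the tail ceiling (same `θ`, same `C`) transports
from `α` to every relabeled table `β` (the full shell sums `Σ_i ½X_{i,k}²` are `σ`-invariant).  So every landed
`CeilingAt` rung (uniform permutation / fan networks, the re-entry pairs, the side-branch classes, …) holds for all
placements. [cite: Tao2016AveragedNS, §4 (4.13)] -/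
theorem kpRelabel_ceilingAt {R ε₀ : ℝ} (hβ : ∀ i₁ i₂ i₃ μ, β i₁ i₂ i₃ μ = α (σ i₁) (σ i₂) (σ i₃) μ)
    (h : CeilingAt R ε₀ α) : CeilingAt R ε₀ β := by
  intro hT hO
  have hα := kpRelabel_symm σ hβ
  obtain ⟨θ, hθ, C, hC, H⟩ := h (kpRelabel_inTableClass σ.symm hα hT) (kpRelabel_orthant σ.symm hα hO)
  refine ⟨θ, hθ, C, hC, ?_⟩
  intro ν hν X₀ s hs X hX0 hXneg hM hXc hXd hXpos n N hnN t ht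
  obtain ⟨M, hM⟩ := hM
  have key := H ν hν (fun j => X₀ (σ.symm j)) s hs (fun j => X (σ.symm j)) (fun j k' => hX0 (σ.symm j) k')
    (fun j k' hk' t' => hXneg (σ.symm j) k' hk' t') ⟨M, fun t' j k' => hM t' (σ.symm j) k'⟩
    (fun j k' => hXc (σ.symm j) k') (kpRelabel_hasDerivWithinAt σ hβ hXd)
    (fun t' ht' j k' hk' => hXpos t' ht' (σ.symm j) k' hk') n N hnN t ht
  rw [kpRelabel_datumEnergy σ X₀] at key
  have hsum : ∀ k : ℕ, ∑ i : Fin 4, (1 / 2 : ℝ) * X (σ.symm i) (k : ℤ) t ^ 2 =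
      ∑ i : Fin 4, (1 / 2 : ℝ) * X i (k : ℤ) t ^ 2 :=
    fun k => Equiv.sum_comp σ.symm (fun i => (1 / 2 : ℝ) * X i (k : ℤ) t ^ 2)
  simpa only [hsum] using key

/-! ## §3 The primary graded barrier (skeleton v6–v19 body, verbatim) under relabeling -/

/-- **The body of `PrimaryGradedAt R ε₀ α` is covariant under relabeling the components** (statement = the
skeleton's `PrimaryGradedAt`, with its structural clauses `GradedStruct α lev`, both unfolded verbatim; the grading
of `β` is `lev ∘ σ`, the exponent `θ` and the constant `D` are unchanged).  Hence a corner of either registered stub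
proved for one placement of an architecture holds for all its placements. [cite: Tao2016AveragedNS, §4 (4.13)] -/
theorem kpRelabel_primaryGraded {R ε₀ : ℝ} (hβ : ∀ i₁ i₂ i₃ μ, β i₁ i₂ i₃ μ = α (σ i₁) (σ i₂) (σ i₃) μ)
    (h : Literature.Analysis.FluidPDE.TaoCascade.InTableClass R α →
      (∀ (Y : Fin 4 → ℤ → ℝ → ℝ) (τ : ℝ), (∀ (j : Fin 4) (k : ℤ), 1 ≤ k → 0 ≤ Y j k τ) → ∀ δ : ℝ, 0 < δ →
        ∀ (i : Fin 4) (n : ℤ), 1 ≤ n → Y i n τ = 0 → 0 ≤ Literature.Analysis.FluidPDE.TaoCascade.quadTerm δ α Y i n τ) →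
      (∀ a b i : Fin 4, a ≠ b → α a b i (0, 0, 1) = 0) →
      ∃ (lev : Fin 4 → ℕ) (L : ℕ), (∀ a, lev a ≤ L) ∧
        (∀ a, lev a ≠ 0 → (∃ e, α a a e (0, 0, 1) ≠ 0) →
          (∀ j, α j j a (0, 0, 1) ≠ 0 → lev j < lev a ∧ (lev j = 0 ∨ ∃ e', α j j e' (0, 0, 1) ≠ 0)) ∧
          (∀ i₁ i₂, i₁ ≠ a → i₂ ≠ a → α i₁ i₂ a (0, 0, 0) ≠ 0 →
            (lev i₁ < lev a ∧ (lev i₁ = 0 ∨ ∃ e', α i₁ i₁ e' (0, 0, 1) ≠ 0)) ∧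
            (lev i₂ < lev a ∧ (lev i₂ = 0 ∨ ∃ e', α i₂ i₂ e' (0, 0, 1) ≠ 0))) ∧
          (∃ e, α a a e (0, 0, 1) ≠ 0 ∧
            (∀ j, α e e j (0, 0, 1) ≠ 0 → lev j < lev a ∧ (lev j = 0 ∨ ∃ e', α j j e' (0, 0, 1) ≠ 0)) ∧
            (∀ j, j ≠ e → α e e j (0, 0, 0) ≠ 0 →
              lev j < lev a ∧ (lev j = 0 ∨ ∃ e', α j j e' (0, 0, 1) ≠ 0)))) ∧
        ∃ θ : ℝ, 1 / 2 < θ ∧ θ ≤ 1 ∧ ∃ D : ℝ, 0 ≤ D ∧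
          ∀ ν : ℝ, 0 < ν → ∀ (X₀ : Fin 4 → ℝ) (s : ℝ), 0 < s → ∀ X : Fin 4 → ℤ → ℝ → ℝ,
          (∀ (i : Fin 4) (k : ℤ), X i k 0 = if k = 0 then X₀ i else 0) →
          (∀ (i : Fin 4) (k : ℤ), k < 0 → ∀ t : ℝ, X i k t = 0) →
          (∃ M : ℝ, ∀ (t : ℝ) (i : Fin 4) (k : ℤ), (1 + (1 + ε₀) ^ ((10 : ℝ) * k)) * |X i k t| ≤ M) →
          (∀ (i : Fin 4) (k : ℤ), Continuous (X i k)) →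
          (∀ (i : Fin 4) (k : ℤ), ∀ t ∈ Set.Icc (0 : ℝ) s, HasDerivWithinAt (X i k)
            (Literature.Analysis.FluidPDE.TaoCascade.quadTerm ε₀ α X i k t - ν * (1 + ε₀) ^ ((2 : ℝ) * k) * X i k t)
            (Set.Icc (0 : ℝ) s) t) →
          (∀ t ∈ Set.Icc (0 : ℝ) s, ∀ (i : Fin 4) (k : ℤ), 1 ≤ k → 0 ≤ X i k t) →
          ∀ t ∈ Set.Icc (0 : ℝ) s, ∀ i, lev i = 0 → ∀ k : ℕ,
            (1 + ε₀) ^ (2 * θ * (k : ℝ)) * ((1 / 2 : ℝ) * X i (k : ℤ) t ^ 2) ≤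
              D * (∑ j : Fin 4, (1 / 2 : ℝ) * X₀ j ^ 2)) :
    Literature.Analysis.FluidPDE.TaoCascade.InTableClass R β →
      (∀ (Y : Fin 4 → ℤ → ℝ → ℝ) (τ : ℝ), (∀ (j : Fin 4) (k : ℤ), 1 ≤ k → 0 ≤ Y j k τ) → ∀ δ : ℝ, 0 < δ →
        ∀ (i : Fin 4) (n : ℤ), 1 ≤ n → Y i n τ = 0 → 0 ≤ Literature.Analysis.FluidPDE.TaoCascade.quadTerm δ β Y i n τ) →
      (∀ a b i : Fin 4, a ≠ b → β a b i (0, 0, 1) = 0) →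
      ∃ (lev : Fin 4 → ℕ) (L : ℕ), (∀ a, lev a ≤ L) ∧
        (∀ a, lev a ≠ 0 → (∃ e, β a a e (0, 0, 1) ≠ 0) →
          (∀ j, β j j a (0, 0, 1) ≠ 0 → lev j < lev a ∧ (lev j = 0 ∨ ∃ e', β j j e' (0, 0, 1) ≠ 0)) ∧
          (∀ i₁ i₂, i₁ ≠ a → i₂ ≠ a → β i₁ i₂ a (0, 0, 0) ≠ 0 →
            (lev i₁ < lev a ∧ (lev i₁ = 0 ∨ ∃ e', β i₁ i₁ e' (0, 0, 1) ≠ 0)) ∧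
            (lev i₂ < lev a ∧ (lev i₂ = 0 ∨ ∃ e', β i₂ i₂ e' (0, 0, 1) ≠ 0))) ∧
          (∃ e, β a a e (0, 0, 1) ≠ 0 ∧
            (∀ j, β e e j (0, 0, 1) ≠ 0 → lev j < lev a ∧ (lev j = 0 ∨ ∃ e', β j j e' (0, 0, 1) ≠ 0)) ∧
            (∀ j, j ≠ e → β e e j (0, 0, 0) ≠ 0 →
              lev j < lev a ∧ (lev j = 0 ∨ ∃ e', β j j e' (0, 0, 1) ≠ 0)))) ∧
        ∃ θ : ℝ, 1 / 2 < θ ∧ θ ≤ 1 ∧ ∃ D : ℝ, 0 ≤ D ∧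
          ∀ ν : ℝ, 0 < ν → ∀ (X₀ : Fin 4 → ℝ) (s : ℝ), 0 < s → ∀ X : Fin 4 → ℤ → ℝ → ℝ,
          (∀ (i : Fin 4) (k : ℤ), X i k 0 = if k = 0 then X₀ i else 0) →
          (∀ (i : Fin 4) (k : ℤ), k < 0 → ∀ t : ℝ, X i k t = 0) →
          (∃ M : ℝ, ∀ (t : ℝ) (i : Fin 4) (k : ℤ), (1 + (1 + ε₀) ^ ((10 : ℝ) * k)) * |X i k t| ≤ M) →
          (∀ (i : Fin 4) (k : ℤ), Continuous (X i k)) →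
          (∀ (i : Fin 4) (k : ℤ), ∀ t ∈ Set.Icc (0 : ℝ) s, HasDerivWithinAt (X i k)
            (Literature.Analysis.FluidPDE.TaoCascade.quadTerm ε₀ β X i k t - ν * (1 + ε₀) ^ ((2 : ℝ) * k) * X i k t)
            (Set.Icc (0 : ℝ) s) t) →
          (∀ t ∈ Set.Icc (0 : ℝ) s, ∀ (i : Fin 4) (k : ℤ), 1 ≤ k → 0 ≤ X i k t) →
          ∀ t ∈ Set.Icc (0 : ℝ) s, ∀ i, lev i = 0 → ∀ k : ℕ,
            (1 + ε₀) ^ (2 * θ * (k : ℝ)) * ((1 / 2 : ℝ) * X i (k : ℤ) t ^ 2) ≤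
              D * (∑ j : Fin 4, (1 / 2 : ℝ) * X₀ j ^ 2) := by
  intro hTβ hOβ hDβ
  have hα := kpRelabel_symm σ hβ
  obtain ⟨lev, L, hL, hG, θ, hθ, hθ1, D, hD, H⟩ :=
    h (kpRelabel_inTableClass σ.symm hα hTβ) (kpRelabel_orthant σ.symm hα hOβ) (kpRelabel_diagonal σ.symm hα hDβ)
  refine ⟨fun a => lev (σ a), L, fun a => hL (σ a), ?_, θ, hθ, hθ1, D, hD, ?_⟩
  · -- the structural clauses transport along `σ`
    intro a ha hsrc
    -- admissibility of a mode of `β` = admissibility of the corresponding mode of `α`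
    have hadm : ∀ j : Fin 4, (lev (σ j) < lev (σ a) ∧ (lev (σ j) = 0 ∨ ∃ e', α (σ j) (σ j) e' (0, 0, 1) ≠ 0)) →
        (lev (σ j) < lev (σ a) ∧ (lev (σ j) = 0 ∨ ∃ e', β j j e' (0, 0, 1) ≠ 0)) := by
      rintro j ⟨h1, h2⟩
      refine ⟨h1, h2.imp_right ?_⟩
      rintro ⟨e', he'⟩
      refine ⟨σ.symm e', ?_⟩
      rw [hβ, Equiv.apply_symm_apply]
      exact he'
    have hsrc' : ∃ e, α (σ a) (σ a) e (0, 0, 1) ≠ 0 := by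
      obtain ⟨e, he⟩ := hsrc
      exact ⟨σ e, by rw [← hβ]; exact he⟩
    obtain ⟨C1, C2, C3⟩ := hG (σ a) ha hsrc'
    refine ⟨fun j hj => hadm j (C1 (σ j) (by rw [← hβ]; exact hj)), fun i₁ i₂ h1 h2 h12 => ?_, ?_⟩
    · have h' := C2 (σ i₁) (σ i₂) (fun e => h1 (σ.injective e)) (fun e => h2 (σ.injective e))
        (by rw [← hβ]; exact h12)
      exact ⟨hadm i₁ h'.1, hadm i₂ h'.2⟩
    · obtain ⟨e, he, Ce1, Ce2⟩ := C3
      refine ⟨σ.symm e, ?_, fun j hj => hadm j (Ce1 (σ j) ?_), fun j hje hj => hadm j (Ce2 (σ j) ?_ ?_)⟩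
      · rw [hβ, Equiv.apply_symm_apply]
        exact he
      · rw [hβ, Equiv.apply_symm_apply] at hj
        exact hj
      · intro h'
        apply hje
        rw [← h', Equiv.symm_apply_apply]
      · rw [hβ, Equiv.apply_symm_apply] at hj
        exact hj
  · -- the barrier of the primaries transports along relabeled solutions
    intro ν hν X₀ s hs X hX0 hXneg hM hXc hXd hXpos t ht i hi k
    obtain ⟨M, hM⟩ := hM
    have key := H ν hν (fun j => X₀ (σ.symm j)) s hs (fun j => X (σ.symm j)) (fun j k' => hX0 (σ.symm j) k')
      (fun j k' hk' t' => hXneg (σ.symm j) k' hk' t') ⟨M, fun t' j k' => hM t' (σ.symm j) k'⟩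
      (fun j k' => hXc (σ.symm j) k') (kpRelabel_hasDerivWithinAt σ hβ hXd)
      (fun t' ht' j k' hk' => hXpos t' ht' (σ.symm j) k' hk') t ht (σ i) hi k
    rw [kpRelabel_datumEnergy σ X₀] at key
    simpa only [Equiv.symm_apply_apply] using key

/-! ## §4 The per-table body of the crux under relabeling -/

/-- **The per-table body `FwdCeilingKPAt R ε₀ α` of `ForwardTailCeilingKP` (verbatim) is covariant under
relabeling**: the forward-source set of `β` is `S.map σ⁻¹`, `θ` and `C` are unchanged.
[cite: Tao2016AveragedNS, §4 (4.13)] -/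
theorem kpRelabel_fwdCeilingKPAt {R ε₀ : ℝ} (hβ : ∀ i₁ i₂ i₃ μ, β i₁ i₂ i₃ μ = α (σ i₁) (σ i₂) (σ i₃) μ)
    (h : Literature.Analysis.FluidPDE.TaoCascade.InTableClass R α → (∀ (Y : Fin 4 → ℤ → ℝ → ℝ) (τ : ℝ), (∀ (j : Fin 4) (k : ℤ), 1 ≤ k → 0 ≤ Y j k τ) → ∀ δ : ℝ, 0 < δ → ∀ (i : Fin 4) (n : ℤ), 1 ≤ n → Y i n τ = 0 → 0 ≤ Literature.Analysis.FluidPDE.TaoCascade.quadTerm δ α Y i n τ) → (∀ a b i : Fin 4, a ≠ b → α a b i (0, 0, 1) = 0) → ∃ S : Finset (Fin 4), (∀ i, i ∉ S → ∀ j l : Fin 4, α i j l (0, 0, 1) = 0) ∧ ∃ θ : ℝ, 1 / 2 < θ ∧ ∃ C : ℝ, 0 ≤ C ∧ ∀ ν : ℝ, 0 < ν → ∀ (X₀ : Fin 4 → ℝ) (s : ℝ), 0 < s → ∀ X : Fin 4 → ℤ → ℝ → ℝ, (∀ (i : Fin 4) (k : ℤ), X i k 0 = if k = 0 then X₀ i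 else 0) → (∀ (i : Fin 4) (k : ℤ), k < 0 → ∀ t : ℝ, X i k t = 0) → (∃ M : ℝ, ∀ (t : ℝ) (i : Fin 4) (k : ℤ), (1 + (1 + ε₀) ^ ((10 : ℝ) * k)) * |X i k t| ≤ M) → (∀ (i : Fin 4) (k : ℤ), Continuous (X i k)) → (∀ (i : Fin 4) (k : ℤ), ∀ t ∈ Set.Icc (0 : ℝ) s, HasDerivWithinAt (X i k) (Literature.Analysis.FluidPDE.TaoCascade.quadTerm ε₀ α X i k t - ν * (1 + ε₀) ^ ((2 : ℝ) * k) * X i k t) (Set.Icc (0 : ℝ) s) t) → (∀ t ∈ Set.Icc (0 : ℝ) s, ∀ (i : Fin 4) (k : ℤ), 1 ≤ k → 0 ≤ X i k t) → ∀ n N : ℕ, n ≤ N → ∀ t ∈ Set.Icc (0 : ℝ) s, ∑ k ∈ Finset.Icc n N, ∑ i ∈ S, (1 / 2 : ℝ) * X i (k : ℤ) t ^ 2 ≤ C * (∑ i : Fin 4, (1 / 2 : ℝ) * X₀ i ^ 2) * (1 + ε₀) ^ (-(2 * θ * (n : ℝ)))) :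
    Literature.Analysis.FluidPDE.TaoCascade.InTableClass R β → (∀ (Y : Fin 4 → ℤ → ℝ → ℝ) (τ : ℝ), (∀ (j : Fin 4) (k : ℤ), 1 ≤ k → 0 ≤ Y j k τ) → ∀ δ : ℝ, 0 < δ → ∀ (i : Fin 4) (n : ℤ), 1 ≤ n → Y i n τ = 0 → 0 ≤ Literature.Analysis.FluidPDE.TaoCascade.quadTerm δ β Y i n τ) → (∀ a b i : Fin 4, a ≠ b → β a b i (0, 0, 1) = 0) → ∃ S : Finset (Fin 4), (∀ i, i ∉ S → ∀ j l : Fin 4, β i j l (0, 0, 1) = 0) ∧ ∃ θ : ℝ, 1 / 2 < θ ∧ ∃ C : ℝ, 0 ≤ C ∧ ∀ ν : ℝ, 0 < ν → ∀ (X₀ : Fin 4 → ℝ) (s : ℝ), 0 < s → ∀ X : Fin 4 → ℤ → ℝ → ℝ, (∀ (i : Fin 4) (k : ℤ), X i k 0 = if k = 0 then X₀ i else 0) → (∀ (i : Fin 4) (k : ℤ), k < 0 → ∀ t : ℝ, X i k t = 0) → (∃ M : ℝ, ∀ (t : ℝ) (i : Fin 4) (k : ℤ), (1 + (1 + ε₀)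 ^ ((10 : ℝ) * k)) * |X i k t| ≤ M) → (∀ (i : Fin 4) (k : ℤ), Continuous (X i k)) → (∀ (i : Fin 4) (k : ℤ), ∀ t ∈ Set.Icc (0 : ℝ) s, HasDerivWithinAt (X i k) (Literature.Analysis.FluidPDE.TaoCascade.quadTerm ε₀ β X i k t - ν * (1 + ε₀) ^ ((2 : ℝ) * k) * X i k t) (Set.Icc (0 : ℝ) s) t) → (∀ t ∈ Set.Icc (0 : ℝ) s, ∀ (i : Fin 4) (k : ℤ), 1 ≤ k → 0 ≤ X i k t) → ∀ n N : ℕ, n ≤ N → ∀ t ∈ Set.Icc (0 : ℝ) s, ∑ k ∈ Finset.Icc n N, ∑ i ∈ S, (1 / 2 : ℝ) * X i (k : ℤ) t ^ 2 ≤ C * (∑ i : Fin 4, (1 / 2 : ℝ) * X₀ i ^ 2) * (1 + ε₀) ^ (-(2 * θ * (n : ℝ))) := by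
  intro hTβ hOβ hDβ
  have hα := kpRelabel_symm σ hβ
  obtain ⟨S, hS, θ, hθ, C, hC, H⟩ :=
    h (kpRelabel_inTableClass σ.symm hα hTβ) (kpRelabel_orthant σ.symm hα hOβ) (kpRelabel_diagonal σ.symm hα hDβ)
  refine ⟨S.map σ.symm.toEmbedding, ?_, θ, hθ, C, hC, ?_⟩
  · intro i hi j l
    rw [hβ]
    refine hS (σ i) ?_ (σ j) (σ l)
    intro hmem
    apply hi
    rw [Finset.mem_map]
    exact ⟨σ i, hmem, by simp⟩
  · intro ν hν X₀ s hs X hX0 hXneg hM hXc hXd hXpos n N hnN t ht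
    obtain ⟨M, hM⟩ := hM
    have key := H ν hν (fun j => X₀ (σ.symm j)) s hs (fun j => X (σ.symm j)) (fun j k' => hX0 (σ.symm j) k')
      (fun j k' hk' t' => hXneg (σ.symm j) k' hk' t') ⟨M, fun t' j k' => hM t' (σ.symm j) k'⟩
      (fun j k' => hXc (σ.symm j) k') (kpRelabel_hasDerivWithinAt σ hβ hXd)
      (fun t' ht' j k' hk' => hXpos t' ht' (σ.symm j) k' hk') n N hnN t ht
    rw [kpRelabel_datumEnergy σ X₀] at key
    have hsum : ∀ k : ℕ, ∑ i ∈ S.map σ.symm.toEmbedding, (1 / 2 : ℝ) * X i (k : ℤ) t ^ 2 =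
        ∑ i ∈ S, (1 / 2 : ℝ) * X (σ.symm i) (k : ℤ) t ^ 2 := fun k => by
      rw [Finset.sum_map]
      rfl
    simpa only [hsum] using key

/-! ## §5 First use: the Katz–Pavlović chain on any component -/

/-- **The KP chain on ANY component obeys the ν-uniform shell barrier at every `b ∈ [34/25, 2]`**: if
`β i₁ i₂ i₃ μ = c·dyadicTable (σ i₁) (σ i₂) (σ i₃) μ` (`c > 0`; the chain sits on component `σ⁻¹ 0`), then
`ShellBarrierAt R ε₀ β` for every `R` and every `ε₀ ∈ [9/25, 1]` — the landed RUNG 18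
`dyadicGapRange10Wide_shellBarrierAt` (placement on component `0`) transported by `kpRelabel_shellBarrierAt`.
[cite: BarbatoMorandinRomito2011, §2 Lemma 2.1 and §3.2] -/
theorem kpRelabel_chain_shellBarrierAt {c : ℝ} (hc : 0 < c)
    (hβ : ∀ i₁ i₂ i₃ μ, β i₁ i₂ i₃ μ = c * dyadicTable (σ i₁) (σ i₂) (σ i₃) μ) :
    ∀ R : ℝ, ∀ ε₀ : ℝ, (9 : ℝ) / 25 ≤ ε₀ → ε₀ ≤ 1 → ShellBarrierAt R ε₀ β :=
  fun R ε₀ h1 h2 =>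
    kpRelabel_shellBarrierAt σ (α := fun i₁ i₂ i₃ μ => c * dyadicTable i₁ i₂ i₃ μ) hβ
      (dyadicGapRange10Wide_shellBarrierAt R ε₀ h1 h2 _ ⟨c, hc, fun _ _ _ _ => rfl⟩)

end Summit.NavierStokesRegularity.NavierStokesRegularity.Theorems

end
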